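import Summits.AtomisticToContinuum.Crystallization.Theorems.FrustratedLawDichotomyStrainedPatchHomCurvLJAnisoM
import Summits.AtomisticToContinuum.Crystallization.Theorems.FrustratedLawDichotomyStrainedPatchHomCurvLJGate

/-!
# KERNEL: the FULL quadratic-form force-Jacobian floor at the corner of record (two-stage cell `U 2⁻¹¹ × ξ .00125`)

decomp-a2c hand-1 g28 (crux `AperiodicFrustratedLawGap`, stmt-AtomisticToContinuum-27623; `(H) HomFloor (1/625)`, hcp half; BUDGET-F T″ second stage,
critic row 1089 (2)(c)).  With `D80 = SC·[[7,0,0],[0,6,−5],[0,−5,33]]` (≈ 0.8× the corner force-Jacobian `[[8.75,0,0],[0,7.96,−5.85],[0,−5.85,41.7]]`):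
★★ `curvLamLJM_corner_D80`: the certified floor of `M − D80` on the gate cell is `> SC/2`, i.e. for every `U, ξ₀, ξ` of the box and `s ∈ (0,1)`
`⟨Δ,(D80/SC + ½)Δ⟩ ≤ Σ_b segGd V′_LJ (p_b(ξ₀)) Δ s`, `Δ = U(ξ−ξ₀)` (`…HomCurvLJAnisoM.curvLJ_floorM_of_check`).  Consequence (float, ring lemma with
`σ₁ + f₀ = 0.0108 + 0.0097`, `f₀` = `…HomSlopeLJ.slopeGsLJ` at this box): every non-exempt shuffle of the box has `|Δ_c| ≤ 1.16e-3`, `|Δ_basal| ≤ 3.6e-3`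
⇒ misfit cost `1.7·1.16e-3 + 0.03·3.6e-3 = 2.1e-3 <` the corner window `3.7e-3` (isotropic floor 6.5: `|Δ_c| ≤ 2.9e-3`, cost 5.4e-3 ✗).

One kernel definition + one kernel fact (`decide +kernel`, ≈ 95 s); 0 sorry; standard axioms.  `--supports stmt-AtomisticToContinuum-27623`.
-/

namespace Summit.AtomisticToContinuum.Crystallization.Theorems.FrustratedLawDichotomyStrainedPatchHomCurvLJ

open Literature.Analysis.ValidatedNumerics.Numerics

/-- `D80 = SC·[[7,0,0],[0,6,−5],[0,−5,33]]` (≈ 0.8 × the corner force-Jacobian, leaf coordinates x, y, c). -/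
def D80 : Fin 3 → Fin 3 → ℤ := fun i j => (![![7, 0, 0], ![0, 6, -5], ![0, -5, 33]] : Fin 3 → Fin 3 → ℤ) i j * 281474976710656

/-- ★★ KERNEL: the `D80`-shifted LJ force-Jacobian floor at the corner gate cell is `> 1/2`. -/
theorem curvLamLJM_corner_D80 :
    ((curvLamLJM cCorner wGate (cenLJ cCorner wGate) (naiLJ cCorner wGate) D80).map fun z => decide ((SC : ℤ) < 2 * z)) = some true := by
  decide +kernel

end Summit.AtomisticToContinuum.Crystallization.Theorems.FrustratedLawDichotomyStrainedPatchHomCurvLJ
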